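import Summits.AtomisticToContinuum.FouriersLaw.Theorems.BondHeatUncertaintySubdiffusiveBondHeatJunctionRatioTransferCalculus

/-!
# BondHeatUncertainty › SubdiffusiveBondHeat › JunctionRatio › TransferSize

Third file of the [LM] `TransferMoment` proof: the bookkeeping for polynomial size control.

* §H1 a small algebra of bounds `|u| ≤ C · mᵏ` (closed under `*`, `+`, `−`, degree raising);
* §H2 degree-zero bounds `|φ| ≤ 1`, `|φ′| ≤ 3β + 1`, `|φ″| ≤ 18β` for `φ = 1/V″ = 1/(1 + 3βr²)` and cubic /
  quadratic growth of `U′, V′` / `U″, V″`;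
* §H3 the three-site size `m(x) = 1 + |q₀| + |q₁| + |q₂| + |p₀| + |p₁| + |p₂|` (`hotSize`), its atoms, and
  `m(x)⁸ ≤ 2⁴² (1 + q₀⁸ + q₁⁸ + q₂⁸ + p₀⁸ + p₁⁸ + p₂⁸)` (`hotSize_pow_eight_le`).

All [calculus] / [bookkeeping]; no measure theory here; constants independent of `N` and `T`.
-/

noncomputable section

open MeasureTheory Filter Topology Set
open scoped BigOperators

namespace Summit.AtomisticToContinuum.FouriersLaw.Theorems.SubdiffusiveBondHeat

namespace EscapeGrading

open Literature.MathematicalPhysics.KineticTheory.HeatConduction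

variable {N : ℕ} {ω₂ lam β γ : ℝ}

/-! ## H1. Bound algebra: `|u| ≤ C · m^k` is closed under the ring operations -/

section Bnd

variable {m : ℝ}

/-- Products: `|u| ≤ C mⁱ`, `|v| ≤ D mʲ` ⟹ `|uv| ≤ C D m^{i+j}`. [bookkeeping] -/
theorem bnd_mul {u v C D : ℝ} {i j : ℕ} (hu : |u| ≤ C * m ^ i) (hv : |v| ≤ D * m ^ j) :
    |u * v| ≤ C * D * m ^ (i + j) := by
  rw [abs_mul, pow_add, mul_mul_mul_comm]
  exact mul_le_mul hu hv (abs_nonneg v) ((abs_nonneg u).trans hu)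

/-- Sums at equal degree: `|u + v| ≤ (C + D) mᵏ`. [bookkeeping] -/
theorem bnd_add {u v C D : ℝ} {k : ℕ} (hu : |u| ≤ C * m ^ k) (hv : |v| ≤ D * m ^ k) :
    |u + v| ≤ (C + D) * m ^ k := by
  rw [add_mul]
  exact (abs_add_le u v).trans (add_le_add hu hv)

/-- Differences at equal degree: `|u − v| ≤ (C + D) mᵏ`. [bookkeeping] -/
theorem bnd_sub {u v C D : ℝ} {k : ℕ} (hu : |u| ≤ C * m ^ k) (hv : |v| ≤ D * m ^ k) :
    |u - v| ≤ (C + D) * m ^ k := by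
  rw [add_mul]
  exact (abs_sub u v).trans (add_le_add hu hv)

/-- Raising the degree: `|u| ≤ C mⁱ ≤ C mʲ` for `i ≤ j`, `m ≥ 1`. [bookkeeping] -/
theorem bnd_lift {u C : ℝ} {i j : ℕ} (hm : 1 ≤ m) (hij : i ≤ j) (hu : |u| ≤ C * m ^ i) :
    |u| ≤ C * m ^ j := by
  have hmi : 0 < m ^ i := pow_pos (by linarith) i
  have hC : 0 ≤ C := by
    by_contra h
    rw [not_le] at h
    have : C * m ^ i < 0 := mul_neg_of_neg_of_pos h hmi
    linarith [abs_nonneg u]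
  exact hu.trans (mul_le_mul_of_nonneg_left (pow_le_pow_right₀ hm hij) hC)

/-- A non-negative constant has degree `0`. [bookkeeping] -/
theorem bnd_const {c : ℝ} (hc : 0 ≤ c) : |c| ≤ c * m ^ 0 := by
  rw [pow_zero, mul_one, abs_of_nonneg hc]

/-- A bounded quantity has degree `0`. [bookkeeping] -/
theorem bnd_of_le {u c : ℝ} (h : |u| ≤ c) : |u| ≤ c * m ^ 0 := by
  rwa [pow_zero, mul_one]

/-- An atom `|u| ≤ m` has degree `1`. [bookkeeping] -/
theorem bnd_atom {u : ℝ} (h : |u| ≤ m) : |u| ≤ 1 * m ^ 1 := by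
  rwa [one_mul, pow_one]

end Bnd

/-! ## H2. Degree-zero bounds for `φ, φ′, φ″` and growth of the forces -/

/-- `|φ| ≤ 1` (`β ≥ 0`). [calculus] -/
theorem abs_transferPhi_le (hβ : 0 ≤ β) (r : ℝ) : |transferPhi β r| ≤ 1 := by
  have h : (0 : ℝ) < 1 + 3 * β * r ^ 2 := by positivity
  unfold transferPhi
  rw [abs_div, abs_one, abs_of_pos h, div_le_one h]
  nlinarith [mul_nonneg hβ (sq_nonneg r)]

/-- `0 ≤ φ` (`β ≥ 0`). [calculus] -/
theorem transferPhi_nonneg (hβ : 0 ≤ β) (r : ℝ) : 0 ≤ transferPhi β r := by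
  have h : (0 : ℝ) < 1 + 3 * β * r ^ 2 := by positivity
  unfold transferPhi
  positivity

/-- `|φ′(r)| = 6β|r|/(1+3βr²)² ≤ 3β + 1` (`β ≥ 0`; from `2|r| ≤ 1 + r²`). [calculus] -/
theorem abs_transferDPhi_le (hβ : 0 ≤ β) (r : ℝ) : |transferDPhi β r| ≤ 3 * β + 1 := by
  have hD : (0 : ℝ) < 1 + 3 * β * r ^ 2 := by positivity
  set D := 1 + 3 * β * r ^ 2 with hDdef
  have hD1 : 1 ≤ D := by rw [hDdef]; nlinarith [mul_nonneg hβ (sq_nonneg r)]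
  have hD2 : D ≤ D ^ 2 := by
    have h := pow_le_pow_right₀ hD1 (show 1 ≤ 2 by norm_num)
    rwa [pow_one] at h
  unfold transferDPhi
  rw [abs_div, abs_neg, abs_of_pos (pow_pos hD 2), div_le_iff₀ (pow_pos hD 2), abs_mul,
    abs_of_nonneg (by positivity : (0 : ℝ) ≤ 6 * β)]
  have h1 : 2 * |r| ≤ r ^ 2 + 1 := by nlinarith [sq_nonneg (|r| - 1), sq_abs r]
  have h2 : 6 * β * |r| ≤ 3 * β * (r ^ 2 + 1) := by nlinarith [mul_le_mul_of_nonneg_left h1 hβ]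
  have h3 : 3 * β * (r ^ 2 + 1) = (D - 1) + 3 * β := by rw [hDdef]; ring
  have h4 : 3 * β ≤ 3 * β * D ^ 2 := le_mul_of_one_le_right (by positivity) (one_le_pow₀ hD1)
  nlinarith

/-- `|φ″(r)| ≤ 18β` (`β ≥ 0`). [calculus] -/
theorem abs_transferDDPhi_le (hβ : 0 ≤ β) (r : ℝ) : |transferDDPhi β r| ≤ 18 * β := by
  have hD : (0 : ℝ) < 1 + 3 * β * r ^ 2 := by positivity
  set D := 1 + 3 * β * r ^ 2 with hDdef
  have hD1 : 1 ≤ D := by rw [hDdef]; nlinarith [mul_nonneg hβ (sq_nonneg r)]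
  have hD3 : D ≤ D ^ 3 := by
    have h := pow_le_pow_right₀ hD1 (show 1 ≤ 3 by norm_num)
    rwa [pow_one] at h
  unfold transferDDPhi
  rw [abs_div, abs_of_pos (pow_pos hD 3), div_le_iff₀ (pow_pos hD 3), abs_mul,
    abs_of_nonneg (by positivity : (0 : ℝ) ≤ 6 * β)]
  have h1 : |9 * β * r ^ 2 - 1| ≤ 3 * D := by
    rw [hDdef]
    refine abs_le.mpr ⟨?_, ?_⟩
    · nlinarith [mul_nonneg hβ (sq_nonneg r)]
    · nlinarith [mul_nonneg hβ (sq_nonneg r)]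
  have h2 : 6 * β * |9 * β * r ^ 2 - 1| ≤ 6 * β * (3 * D) := mul_le_mul_of_nonneg_left h1 (by positivity)
  nlinarith [mul_le_mul_of_nonneg_left hD3 (by positivity : (0 : ℝ) ≤ 18 * β)]

/-- `|U′(a)| ≤ (ω² + λ) m³` if `|a| ≤ m`, `m ≥ 1`. [calculus] -/
theorem abs_pinForce_le (hω : 0 ≤ ω₂) (hl : 0 ≤ lam) {a m : ℝ} (hm : 1 ≤ m) (ha : |a| ≤ m) :
    |pinForce ω₂ lam a| ≤ (ω₂ + lam) * m ^ 3 := by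
  have h3 : |a| ^ 3 ≤ m ^ 3 := pow_le_pow_left₀ (abs_nonneg a) ha 3
  have hm3 : m ≤ m ^ 3 := by
    have h := pow_le_pow_right₀ hm (show 1 ≤ 3 by norm_num)
    rwa [pow_one] at h
  unfold pinForce
  calc |ω₂ * a + lam * a ^ 3| ≤ |ω₂ * a| + |lam * a ^ 3| := abs_add_le _ _
    _ = ω₂ * |a| + lam * |a| ^ 3 := by
        rw [abs_mul, abs_mul, abs_pow, abs_of_nonneg hω, abs_of_nonneg hl]
    _ ≤ ω₂ * m + lam * m ^ 3 := by gcongr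
    _ ≤ (ω₂ + lam) * m ^ 3 := by nlinarith [mul_le_mul_of_nonneg_left hm3 hω]

/-- `|V′(r)| ≤ (1 + β) m³` if `|r| ≤ m`, `m ≥ 1`. [calculus] -/
theorem abs_bondForce_le (hβ : 0 ≤ β) {r m : ℝ} (hm : 1 ≤ m) (hr : |r| ≤ m) :
    |bondForce β r| ≤ (1 + β) * m ^ 3 := by
  have h3 : |r| ^ 3 ≤ m ^ 3 := pow_le_pow_left₀ (abs_nonneg r) hr 3
  have hm3 : m ≤ m ^ 3 := by
    have h := pow_le_pow_right₀ hm (show 1 ≤ 3 by norm_num)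
    rwa [pow_one] at h
  unfold bondForce
  calc |r + β * r ^ 3| ≤ |r| + |β * r ^ 3| := abs_add_le _ _
    _ = |r| + β * |r| ^ 3 := by rw [abs_mul, abs_pow, abs_of_nonneg hβ]
    _ ≤ m + β * m ^ 3 := by gcongr
    _ ≤ (1 + β) * m ^ 3 := by nlinarith

/-- `|U″(a)| ≤ (ω² + 3λ) m²` if `|a| ≤ m`, `m ≥ 1`. [calculus] -/
theorem abs_pinStiff_le (hω : 0 ≤ ω₂) (hl : 0 ≤ lam) {a m : ℝ} (hm : 1 ≤ m) (ha : |a| ≤ m) :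
    |pinStiff ω₂ lam a| ≤ (ω₂ + 3 * lam) * m ^ 2 := by
  have h2 : |a| ^ 2 ≤ m ^ 2 := pow_le_pow_left₀ (abs_nonneg a) ha 2
  rw [sq_abs] at h2
  have hm2 : 1 ≤ m ^ 2 := one_le_pow₀ hm
  unfold pinStiff
  rw [abs_of_nonneg (by positivity)]
  nlinarith [mul_le_mul_of_nonneg_left h2 hl, mul_le_mul_of_nonneg_left hm2 hω]

/-- `|V″(r)| ≤ (1 + 3β) m²` if `|r| ≤ m`, `m ≥ 1`. [calculus] -/
theorem abs_bondStiff_le (hβ : 0 ≤ β) {r m : ℝ} (hm : 1 ≤ m) (hr : |r| ≤ m) :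
    |bondStiff β r| ≤ (1 + 3 * β) * m ^ 2 := by
  have h2 : |r| ^ 2 ≤ m ^ 2 := pow_le_pow_left₀ (abs_nonneg r) hr 2
  rw [sq_abs] at h2
  have hm2 : 1 ≤ m ^ 2 := one_le_pow₀ hm
  unfold bondStiff
  rw [abs_of_nonneg (by positivity)]
  nlinarith [mul_le_mul_of_nonneg_left h2 hβ]

/-! ## H3. The three-site size `m(x)` -/

/-- `m(x) = 1 + |q₀| + |q₁| + |q₂| + |p₀| + |p₁| + |p₂|` (hot end). -/
def hotSize (N : ℕ) (hN : 3 ≤ N) (x : PhaseSpace N) : ℝ :=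
  1 + |x.1 (site0 hN)| + |x.1 (site1 hN)| + |x.1 (site2 hN)|
    + |x.2 (site0 hN)| + |x.2 (site1 hN)| + |x.2 (site2 hN)|

section Atoms

variable (hN : 3 ≤ N) (x : PhaseSpace N)

/-- The six absolute values in `hotSize` are non-negative. [bookkeeping] -/
private theorem hotSize_nonnegs :
    0 ≤ |x.1 (site0 hN)| ∧ 0 ≤ |x.1 (site1 hN)| ∧ 0 ≤ |x.1 (site2 hN)| ∧
      0 ≤ |x.2 (site0 hN)| ∧ 0 ≤ |x.2 (site1 hN)| ∧ 0 ≤ |x.2 (site2 hN)| :=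
  ⟨abs_nonneg _, abs_nonneg _, abs_nonneg _, abs_nonneg _, abs_nonneg _, abs_nonneg _⟩

/-- `1 ≤ m(x)`. [bookkeeping] -/
theorem one_le_hotSize : 1 ≤ hotSize N hN x := by
  obtain ⟨h0, h1, h2, h3, h4, h5⟩ := hotSize_nonnegs hN x
  unfold hotSize; linarith

/-- `0 < m(x)`. [bookkeeping] -/
theorem hotSize_pos : 0 < hotSize N hN x := lt_of_lt_of_le one_pos (one_le_hotSize hN x)

/-- `|q₀| ≤ m(x)`. [bookkeeping] -/
theorem abs_q0_le_hotSize : |x.1 (site0 hN)| ≤ hotSize N hN x := by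
  obtain ⟨h0, h1, h2, h3, h4, h5⟩ := hotSize_nonnegs hN x
  unfold hotSize; linarith

/-- `|q₁| ≤ m(x)`. [bookkeeping] -/
theorem abs_q1_le_hotSize : |x.1 (site1 hN)| ≤ hotSize N hN x := by
  obtain ⟨h0, h1, h2, h3, h4, h5⟩ := hotSize_nonnegs hN x
  unfold hotSize; linarith

/-- `|q₂| ≤ m(x)`. [bookkeeping] -/
theorem abs_q2_le_hotSize : |x.1 (site2 hN)| ≤ hotSize N hN x := by
  obtain ⟨h0, h1, h2, h3, h4, h5⟩ := hotSize_nonnegs hN x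
  unfold hotSize; linarith

/-- `|p₀| ≤ m(x)`. [bookkeeping] -/
theorem abs_p0_le_hotSize : |x.2 (site0 hN)| ≤ hotSize N hN x := by
  obtain ⟨h0, h1, h2, h3, h4, h5⟩ := hotSize_nonnegs hN x
  unfold hotSize; linarith

/-- `|p₁| ≤ m(x)`. [bookkeeping] -/
theorem abs_p1_le_hotSize : |x.2 (site1 hN)| ≤ hotSize N hN x := by
  obtain ⟨h0, h1, h2, h3, h4, h5⟩ := hotSize_nonnegs hN x
  unfold hotSize; linarith

/-- `|p₂| ≤ m(x)`. [bookkeeping] -/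
theorem abs_p2_le_hotSize : |x.2 (site2 hN)| ≤ hotSize N hN x := by
  obtain ⟨h0, h1, h2, h3, h4, h5⟩ := hotSize_nonnegs hN x
  unfold hotSize; linarith

/-- `|q₁ − q₀| ≤ m(x)` (the `1` in `m` absorbs nothing here: `|q₁| + |q₀| ≤ m`). [bookkeeping] -/
theorem abs_r_le_hotSize : |x.1 (site1 hN) - x.1 (site0 hN)| ≤ hotSize N hN x := by
  obtain ⟨h0, h1, h2, h3, h4, h5⟩ := hotSize_nonnegs hN x
  refine (abs_sub _ _).trans ?_
  unfold hotSize; linarith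

/-- `|q₂ − q₁| ≤ m(x)`. [bookkeeping] -/
theorem abs_s_le_hotSize : |x.1 (site2 hN) - x.1 (site1 hN)| ≤ hotSize N hN x := by
  obtain ⟨h0, h1, h2, h3, h4, h5⟩ := hotSize_nonnegs hN x
  refine (abs_sub _ _).trans ?_
  unfold hotSize; linarith

/-- `|p₁ − p₀| ≤ m(x)`. [bookkeeping] -/
theorem abs_dp_le_hotSize : |x.2 (site1 hN) - x.2 (site0 hN)| ≤ hotSize N hN x := by
  obtain ⟨h0, h1, h2, h3, h4, h5⟩ := hotSize_nonnegs hN x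
  refine (abs_sub _ _).trans ?_
  unfold hotSize; linarith

/-- `|p₂ − p₁| ≤ m(x)`. [bookkeeping] -/
theorem abs_dp2_le_hotSize : |x.2 (site2 hN) - x.2 (site1 hN)| ≤ hotSize N hN x := by
  obtain ⟨h0, h1, h2, h3, h4, h5⟩ := hotSize_nonnegs hN x
  refine (abs_sub _ _).trans ?_
  unfold hotSize; linarith

/-- `|a|⁸ = a⁸`. -/
theorem hot_abs_pow_eight (a : ℝ) : |a| ^ 8 = a ^ 8 := by
  rw [← abs_pow]; exact abs_of_nonneg (by positivity)

/-- `(u + v)⁸ ≤ 2⁷ (u⁸ + v⁸)` for `u, v ≥ 0` (power-mean). [folklore] -/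
theorem hot_add_pow_eight_le {u v : ℝ} (hu : 0 ≤ u) (hv : 0 ≤ v) :
    (u + v) ^ 8 ≤ 128 * (u ^ 8 + v ^ 8) := by
  have h := add_pow_le hu hv 8
  norm_num at h
  exact h

/-- Power-mean step for seven non-negative reals. [calculus] -/
theorem sum7_pow_eight_le {z1 z2 z3 z4 z5 z6 : ℝ} (h1 : 0 ≤ z1) (h2 : 0 ≤ z2) (h3 : 0 ≤ z3)
    (h4 : 0 ≤ z4) (h5 : 0 ≤ z5) (h6 : 0 ≤ z6) :
    (1 + z1 + z2 + z3 + z4 + z5 + z6) ^ 8 ≤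
      2 ^ 42 * (1 + z1 ^ 8 + z2 ^ 8 + z3 ^ 8 + z4 ^ 8 + z5 ^ 8 + z6 ^ 8) := by
  have e1 : (1 + z1) ^ 8 ≤ 128 * (1 + z1 ^ 8) := by
    have h := hot_add_pow_eight_le zero_le_one h1
    rwa [one_pow] at h
  have e2 : (1 + z1 + z2) ^ 8 ≤ 128 * ((1 + z1) ^ 8 + z2 ^ 8) := hot_add_pow_eight_le (by positivity) h2
  have e3 : (1 + z1 + z2 + z3) ^ 8 ≤ 128 * ((1 + z1 + z2) ^ 8 + z3 ^ 8) :=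
    hot_add_pow_eight_le (by positivity) h3
  have e4 : (1 + z1 + z2 + z3 + z4) ^ 8 ≤ 128 * ((1 + z1 + z2 + z3) ^ 8 + z4 ^ 8) :=
    hot_add_pow_eight_le (by positivity) h4
  have e5 : (1 + z1 + z2 + z3 + z4 + z5) ^ 8 ≤ 128 * ((1 + z1 + z2 + z3 + z4) ^ 8 + z5 ^ 8) :=
    hot_add_pow_eight_le (by positivity) h5
  have e6 : (1 + z1 + z2 + z3 + z4 + z5 + z6) ^ 8 ≤
      128 * ((1 + z1 + z2 + z3 + z4 + z5) ^ 8 + z6 ^ 8) := hot_add_pow_eight_le (by positivity) h6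
  have p1 : 0 ≤ z1 ^ 8 := by positivity
  have p2 : 0 ≤ z2 ^ 8 := by positivity
  have p3 : 0 ≤ z3 ^ 8 := by positivity
  have p4 : 0 ≤ z4 ^ 8 := by positivity
  have p5 : 0 ≤ z5 ^ 8 := by positivity
  have p6 : 0 ≤ z6 ^ 8 := by positivity
  generalize (1 + z1) ^ 8 = B1 at e1 e2
  generalize (1 + z1 + z2) ^ 8 = B2 at e2 e3
  generalize (1 + z1 + z2 + z3) ^ 8 = B3 at e3 e4
  generalize (1 + z1 + z2 + z3 + z4) ^ 8 = B4 at e4 e5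
  generalize (1 + z1 + z2 + z3 + z4 + z5) ^ 8 = B5 at e5 e6
  generalize (1 + z1 + z2 + z3 + z4 + z5 + z6) ^ 8 = B6 at e6 ⊢
  generalize z1 ^ 8 = w1 at *
  generalize z2 ^ 8 = w2 at *
  generalize z3 ^ 8 = w3 at *
  generalize z4 ^ 8 = w4 at *
  generalize z5 ^ 8 = w5 at *
  generalize z6 ^ 8 = w6 at *
  linarith

/-- Power-mean step: `m(x)⁸ ≤ 2⁴² (1 + q₀⁸ + q₁⁸ + q₂⁸ + p₀⁸ + p₁⁸ + p₂⁸)`. [calculus] -/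
theorem hotSize_pow_eight_le :
    hotSize N hN x ^ 8 ≤ 2 ^ 42 * (1 + x.1 (site0 hN) ^ 8 + x.1 (site1 hN) ^ 8 + x.1 (site2 hN) ^ 8
      + x.2 (site0 hN) ^ 8 + x.2 (site1 hN) ^ 8 + x.2 (site2 hN) ^ 8) := by
  have h := sum7_pow_eight_le (abs_nonneg (x.1 (site0 hN))) (abs_nonneg (x.1 (site1 hN)))
    (abs_nonneg (x.1 (site2 hN))) (abs_nonneg (x.2 (site0 hN))) (abs_nonneg (x.2 (site1 hN)))
    (abs_nonneg (x.2 (site2 hN)))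
  simp only [hot_abs_pow_eight] at h
  exact h

end Atoms

end EscapeGrading

end Summit.AtomisticToContinuum.FouriersLaw.Theorems.SubdiffusiveBondHeat
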